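import Mathlib
import Literature.NumberTheory.LFunctions.Zhang2022.Section16Eq1610
import Literature.NumberTheory.LFunctions.Zhang2022.Section16Eq1610NumericX
import Literature.NumberTheory.LFunctions.Zhang2022.Section16AEq1612Closer
import Literature.NumberTheory.LFunctions.Zhang2022.Section16AEq1610Glue
import Literature.NumberTheory.LFunctions.Zhang2022.Section16ACalM2Analytic
import HarnessLib

/-!
# Zhang (2022) §16: (16.10) on the whole support of `b₁`, and the leaf `Eq16_12 c′` — CLOSED

Topic `Literature/NumberTheory/LFunctions/Zhang2022` (Landau–Siegel audit tree; verdict-neutral).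
Y. Zhang, *Discrete mean estimates and the Landau–Siegel zero*, arXiv:2211.02515v1 (2022)
[Zhang2022LandauSiegel] — **an unrefereed manuscript under adjudication** (ZHANG-L discharge lane, WP16).
The leaf `Typed.Section16A.Eq16_12 c′` (hypothesis `h16_12` of the skeleton; display (16.12) [Z22 p. 92,
tex L4558]: `Φ₂(p) = (ℛ₂*Dp/φ(D))Σ_{j=1,2} ℛ₂ⱼ𝒮₂ⱼ + o(p)` under (A)).

* `div_P4_rpow_le_supp` — "`P₄/d > T`" on the SUPPORT of `b₁`: for `d ≤ dl < 2T²P^{1/2}max(P₂,P₃) = 2PT⁻⁸`,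
  `d/P₄ ≤ T⁻⁶`, so `(d/P₄)^η ≤ e^{−6η𝓛^{1.1}}` (the printed range `dl < P₂²` of (16.10) gives `T⁻¹⁸`,
  `Eq1610.div_P4_rpow_le`; the insertion into (16.5) needs the whole support, RANGE NOTE of
  `Section16AEq1612Assembly`);
* `integral_u023_sub_residues_le_supp` — zl-w16-p5's contour theorem `Eq1610.integral_u023_sub_residues_le`
  (the §16.u023 integral minus the residues at `−β₁, −β₂` is `≪ ∏_{q∣dl}(1+c/q^{9/10})·𝓛⁻²⁰⁰⁰` under (A))
  re-run verbatim on the support range, the left-segment saving being `e^{−(3c/4)𝓛^{1/10}}` instead of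
  `e^{−(9c/4)𝓛^{1/10}}` (`Eq1610.numeric_bound_X`);
* `eq16_10W_holds` — **(16.10) in the weighted/polynomial reading of record** (RT16-int-2 amended): by
  `Typed.Section16A.eq16_10W_of_integral_bound_pow` (u023 `step16_u023_holds` + `λ₂(d,1)`-absorption) from the
  above and `step16_u021an_holds`, `step16_u022_holds`;
* `eq16_12_holds : ∀ c′, Eq16_12 c′` — **the leaf**, by `eq16_12_of_eq16_10W` (the chain (16.3) → u011 → (16.4)
  → u012 → u015 (`DeltaContourShift`, zl-libC-p3) → u018 → (16.5)ᴾ (`eq16_5P_holds`) → (16.6)/u020–u023 →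
  (16.10) → (16.12), every link a tree theorem).

PRINT vs LEAN (documented, not repaired): the printed error `O(ε₁)`, `ε₁ = exp(−c𝓛^{1/10})`, of (16.10) is not
what the contour argument yields under (A) (the residue at the exceptional-zero pole `ρ̃ − 1` is only
`O(𝓛⁻²⁰⁰³‖ℳ₂‖)`, `Section16Eq1610`); the polynomial rate is ample for (16.12), whose error is `o(p)`.
CONDITIONAL on (A) inside `ForAllLarge`, exactly as the manuscript (the lane proves `(A) → …`; (A) is refuted
nowhere here and asserted nowhere). No new definitions, no named facts, no `sorry`. Nothing in this file is a
claim about Landau–Siegel zeros or about Theorems 1–2 of the source.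

## References

* Y. Zhang, arXiv:2211.02515v1 (2022), §16 pp. 89–92, (16.10) tex L4550, (16.12) tex L4558.
  [cite: Zhang2022LandauSiegel, §16 (16.12) p.92]
-/

noncomputable section

open Complex Real Filter Topology Set MeasureTheory
open Literature.NumberTheory.LFunctions.Zhang2022
open Literature.NumberTheory.LFunctions.Zhang2022.Skeleton
open Literature.NumberTheory.LFunctions.Zhang2022.Typed.Section16A

namespace Literature.NumberTheory.LFunctions.Zhang2022.Eq1610

section Params

variable {D : ℕ}

/-- **The support of `b₁` sits below `P₄T⁻⁶`**: for `𝓛 ≥ 8`,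
`2T²P^{1/2}max(P₂,P₃) ≤ P₄·T⁻⁶` (`2T²P^{1/2}P₂ = 2PT⁻⁸ ≤ t₀PT⁻⁸`; `2T²P^{1/2}P₃ = 2T²P^{0.998} ≤ t₀PT⁻⁸` as
`2T¹⁰ ≤ P^{0.002}`, i.e. `log 2 + 10𝓛^{1.1} ≤ 0.002𝓛⁹`). [cite: Zhang2022LandauSiegel, §16 (16.10) p.92] -/
theorem suppBound_le_P4_div_T6 (hL : 8 ≤ ell D) :
    2 * bigT D ^ 2 * (bigP D ^ (1 / 2 : ℝ) * max (Skeleton.P2 D) (P3 D)) ≤ P4 D * (bigT D ^ 6)⁻¹ := by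
  have hℓ1 : 1 ≤ ell D := by linarith
  have hℓ0 : 0 < ell D := by linarith
  set L : ℝ := ell D with hLdef
  have hT : bigT D = Real.exp (L ^ (1.1 : ℝ)) := by rw [bigT]
  have hP : bigP D = Real.exp (L ^ 9) := by rw [bigP]
  have hPh : bigP D ^ (1 / 2 : ℝ) = Real.exp (L ^ 9 * (1 / 2)) := by rw [hP, ← Real.exp_mul]
  have hP2 : Skeleton.P2 D = Real.exp (L ^ 9 * 0.5) / Real.exp (L ^ (1.1 : ℝ)) ^ 10 := by
    rw [Skeleton.P2, hP, ← Real.exp_mul, hT]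
  have hP3 : P3 D = Real.exp (L ^ 9 * 0.498) := by rw [P3, hP, ← Real.exp_mul]
  have hP4 : P4 D = Real.exp (L ^ 9) / Real.exp (L ^ (1.1 : ℝ)) ^ 2 * t0 D := by rw [P4, hP, hT]
  have ht0 : 2 ≤ t0 D := by
    rw [t0]
    calc (2 : ℝ) ≤ 8 := by norm_num
      _ ≤ ell D := hL
      _ ≤ ell D ^ 519 := le_self_pow₀ hℓ1 (by norm_num)
  have ht00 : 0 < t0 D := by linarith
  -- everything as exponentials
  have hTpow : ∀ n : ℕ, Real.exp (L ^ (1.1 : ℝ)) ^ n = Real.exp (n * L ^ (1.1 : ℝ)) := fun n => by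
    rw [← Real.exp_nat_mul]
  rw [hT, hPh, hP4, hTpow 2, hTpow 6]
  have h11 : L ^ (1.1 : ℝ) ≤ L ^ 2 := by
    have h := Real.rpow_le_rpow_of_exponent_le hℓ1 (show (1.1 : ℝ) ≤ 2 by norm_num)
    rwa [Real.rpow_two] at h
  have h110 : 0 ≤ L ^ (1.1 : ℝ) := Real.rpow_nonneg hℓ0.le _
  have hL7 : (2097152 : ℝ) ≤ L ^ 7 := by
    calc (2097152 : ℝ) = 8 ^ 7 := by norm_num
      _ ≤ L ^ 7 := pow_le_pow_left₀ (by norm_num) hL 7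
  have hL9 : L ^ 9 = L ^ 7 * L ^ 2 := by ring
  have hL2 : 64 ≤ L ^ 2 := by nlinarith
  -- the target in the form `2·e^{a}·max(P₂,P₃) ≤ e^{b}·t₀`
  rcases le_total (Skeleton.P2 D) (P3 D) with h23 | h32
  · -- `max = P₃`: `2e^{2L^{1.1}}e^{L⁹/2}e^{0.498L⁹}·e^{6L^{1.1}} ≤ e^{L⁹ − 2L^{1.1}}·t₀`
    rw [max_eq_right h23, hP3, le_mul_inv_iff₀ (Real.exp_pos _), ← Real.exp_sub]
    have key : 2 * Real.exp ((2 : ℕ) * L ^ (1.1 : ℝ)) *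
        (Real.exp (L ^ 9 * (1 / 2)) * Real.exp (L ^ 9 * 0.498)) * Real.exp ((6 : ℕ) * L ^ (1.1 : ℝ)) =
        2 * Real.exp (8 * L ^ (1.1 : ℝ) + L ^ 9 * 0.998) := by
      rw [show 8 * L ^ (1.1 : ℝ) + L ^ 9 * 0.998 =
          (2 : ℕ) * L ^ (1.1 : ℝ) + (L ^ 9 * (1 / 2) + L ^ 9 * 0.498) + (6 : ℕ) * L ^ (1.1 : ℝ) by
            push_cast; ring,
        Real.exp_add, Real.exp_add, Real.exp_add]
      ring
    rw [key]
    have hexp : Real.exp (8 * L ^ (1.1 : ℝ) + L ^ 9 * 0.998) ≤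
        Real.exp (L ^ 9 - (2 : ℕ) * L ^ (1.1 : ℝ)) := by
      refine Real.exp_le_exp.mpr ?_
      push_cast
      nlinarith [h11, hL7, hL2, h110]
    calc 2 * Real.exp (8 * L ^ (1.1 : ℝ) + L ^ 9 * 0.998)
        ≤ t0 D * Real.exp (L ^ 9 - (2 : ℕ) * L ^ (1.1 : ℝ)) :=
          mul_le_mul ht0 hexp (Real.exp_pos _).le ht00.le
      _ = Real.exp (L ^ 9 - (2 : ℕ) * L ^ (1.1 : ℝ)) * t0 D := mul_comm _ _
  · -- `max = P₂`: `2e^{2L^{1.1}}e^{L⁹/2}e^{L⁹/2}e^{−10L^{1.1}}·e^{6L^{1.1}} = 2e^{L⁹ − 2L^{1.1}} ≤ t₀e^{L⁹ − 2L^{1.1}}`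
    rw [max_eq_left h32, hP2, hTpow 10, le_mul_inv_iff₀ (Real.exp_pos _)]
    have key : 2 * Real.exp ((2 : ℕ) * L ^ (1.1 : ℝ)) *
        (Real.exp (L ^ 9 * (1 / 2)) * (Real.exp (L ^ 9 * 0.5) / Real.exp ((10 : ℕ) * L ^ (1.1 : ℝ)))) *
        Real.exp ((6 : ℕ) * L ^ (1.1 : ℝ)) = 2 * Real.exp (L ^ 9 - (2 : ℕ) * L ^ (1.1 : ℝ)) := by
      rw [show L ^ 9 - (2 : ℕ) * L ^ (1.1 : ℝ) =
          (2 : ℕ) * L ^ (1.1 : ℝ) + (L ^ 9 * (1 / 2) + (L ^ 9 * 0.5 - (10 : ℕ) * L ^ (1.1 : ℝ))) +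
            (6 : ℕ) * L ^ (1.1 : ℝ) by push_cast; ring,
        Real.exp_add, Real.exp_add, Real.exp_add, Real.exp_sub]
      ring
    rw [key, ← Real.exp_sub]
    calc 2 * Real.exp (L ^ 9 - (2 : ℕ) * L ^ (1.1 : ℝ))
        ≤ t0 D * Real.exp (L ^ 9 - (2 : ℕ) * L ^ (1.1 : ℝ)) :=
          mul_le_mul_of_nonneg_right ht0 (Real.exp_pos _).le
      _ = Real.exp (L ^ 9 - (2 : ℕ) * L ^ (1.1 : ℝ)) * t0 D := mul_comm _ _

/-- **"`P₄/d > T`" on the support of `b₁`**: for `𝓛 ≥ 8`, `d ≤ x < 2T²P^{1/2}max(P₂,P₃)` and `η ≥ 0`,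
`(d/P₄)^η ≤ exp(−6η𝓛^{1.1})`. [cite: Zhang2022LandauSiegel, §16 (16.10) p.92] -/
theorem div_P4_rpow_le_supp (hL : 8 ≤ ell D) {d : ℕ} {x : ℝ} (hdx : (d : ℝ) ≤ x)
    (hx : x < 2 * bigT D ^ 2 * (bigP D ^ (1 / 2 : ℝ) * max (Skeleton.P2 D) (P3 D))) {η : ℝ} (hη : 0 ≤ η) :
    ((d : ℝ) / P4 D) ^ η ≤ Real.exp (-(6 * η * ell D ^ (1.1 : ℝ))) := by
  have hT0 : 0 < bigT D := Real.exp_pos _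
  have hP4 := ResidueValues.P4_pos (D := D) (by linarith)
  have hS := suppBound_le_P4_div_T6 hL
  have hdP : (d : ℝ) / P4 D ≤ (bigT D ^ 6)⁻¹ := by
    rw [div_le_iff₀ hP4]
    have : (d : ℝ) ≤ P4 D * (bigT D ^ 6)⁻¹ := by linarith
    simpa [mul_comm] using this
  have hd0 : 0 ≤ (d : ℝ) / P4 D := div_nonneg (Nat.cast_nonneg d) hP4.le
  have hT6 : (bigT D ^ 6)⁻¹ = Real.exp (-(6 * ell D ^ (1.1 : ℝ))) := by
    rw [bigT, ← Real.exp_nat_mul, ← Real.exp_neg]; push_cast; ring_nf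
  calc ((d : ℝ) / P4 D) ^ η ≤ ((bigT D ^ 6)⁻¹) ^ η := Real.rpow_le_rpow hd0 hdP hη
    _ = Real.exp (-(6 * η * ell D ^ (1.1 : ℝ))) := by
        rw [hT6, ← Real.exp_mul]; ring_nf

end Params

section Main

variable (c' : ℝ)

/-- **The §16.u023 integral minus its residues at `−β₁, −β₂`, on the SUPPORT of `b₁`**
(`dl < 2T²P^{1/2}max(P₂,P₃)`): zl-w16-p5's `integral_u023_sub_residues_le` verbatim with the support range —
the only change is the left-segment saving `(d/P₄)^η ≤ e^{−6η𝓛^{1.1}} ≤ e^{−(3c/4)𝓛^{1/10}}` fed to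
`numeric_bound_X`. CONDITIONAL on (A) as the manuscript. [cite: Zhang2022LandauSiegel, §16 (16.10) p.92] -/
theorem integral_u023_sub_residues_le_supp (h21 : Step16_u021an c') (h22 : Step16_u022 c') :
    ∃ c C : ℝ, ForAllLarge fun D _ χ => AssumptionA D χ →
      ∀ d l : ℕ, 1 ≤ d → 1 ≤ l →
        ((d * l : ℕ) : ℝ) < 2 * bigT D ^ 2 * (bigP D ^ (1 / 2 : ℝ) * max (Skeleton.P2 D) (P3 D)) →
        ‖(1 / (2 * π) : ℂ) * (∫ t : ℝ, integrand16_u023 c' χ d l (1 + t * I)) -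
            ∑ j ∈ ({1, 2} : Finset ℕ),
              calR2 c' χ j * (d : ℂ) ^ betaJ c' D j * calM2 c' χ d l (1 - betaJ c' D j)‖ ≤
          C * (∏ q ∈ (d * l).primeFactors, (1 + c / (q : ℝ) ^ (9 / 10 : ℝ))) * (ell D ^ 2000)⁻¹ := by
  -- the packages
  obtain ⟨c₂₂, C₂₂, D₂₂, h22'⟩ := h22
  obtain ⟨D₂₁, h21'⟩ := h21
  obtain ⟨cL, hcL, hcL4, CL, hCL, K₅, hK₅, DE, hE⟩ := Lemma84.exceptional_package
  obtain ⟨cbar, hcbar, -, Cζ, hCζ, hζ⟩ := ZetaClassicalRegion.exists_zeroFreeRegion_bounds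
  obtain ⟨rζ, hrζ, Kζ, -, hζ1⟩ := ResidueValues.zeta_near_one
  obtain ⟨CLβ, -, DLβ, hLβ⟩ := ResidueValues.L_one_sub_beta_bounds
  obtain ⟨Lb, -, hbudget⟩ := gauss_budget_le_one
  obtain ⟨Lg, -, hG⟩ := rpow_le_exp_mul_rpow (k := 2020) (κ := 3 * cL / 4) (ε := 1 / 10)
    (by norm_num) (by positivity) (by norm_num)
  have hκ₂0 : 0 < 8 * cbar / cL := by positivity
  -- the threshold
  obtain ⟨L₀, hL₀64, hL₀b, hL₀g, hL₀κ, hL₀17, hL₀K1, hL₀K2, hL₀K3⟩ : ∃ L₀ : ℝ, 64 ≤ L₀ ∧ Lb ≤ L₀ ∧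
      Lg ≤ L₀ ∧ max 4 ((41 / (8 * cbar / cL)) ^ 2) ≤ L₀ ∧ 1700 ≤ L₀ ∧ 16 * K₅ / cL + 1 ≤ L₀ ∧
      K₅ / rζ + 1 ≤ L₀ ∧ K₅ + 1 ≤ L₀ :=
    ⟨64 + |Lb| + |Lg| + max 4 ((41 / (8 * cbar / cL)) ^ 2) + 1700 + (16 * K₅ / cL + 1) +
        (K₅ / rζ + 1) + (K₅ + 1), by
      have h1 : 0 ≤ max 4 ((41 / (8 * cbar / cL)) ^ 2) := le_trans (by norm_num) (le_max_left _ _)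
      have h2 : 0 ≤ 16 * K₅ / cL + 1 := by positivity
      have h3 : 0 ≤ K₅ / rζ + 1 := by positivity
      have h4 : 0 ≤ K₅ + 1 := by positivity
      have h5 := le_abs_self Lb
      have h6 := le_abs_self Lg
      have h7 := abs_nonneg Lb
      have h8 := abs_nonneg Lg
      refine ⟨by linarith, by linarith, by linarith, by linarith, by linarith, by linarith,
        by linarith, by linarith⟩⟩
  refine ⟨c₂₂, C₂₂ * (48 / π +
      1 / (2 * π) * ((8 / cL + Cζ) * Cζ * (2 * (CL + 1)) * (1 + 16 / cL) * (24 / cL) * 4) +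
      36 * (1 + Cζ) * Cζ * (CL + 1) / π + 2 * (CL + 1) * (2 / π + Cζ) * (2 * K₅) * 3 * (3 / π)),
    max (max ⌈Real.exp 3⌉₊ ⌈Real.exp (14 * |c'| * π)⌉₊)
      (max (max D₂₁ D₂₂) (max (max DE DLβ) ⌈Real.exp L₀⌉₊)),
    fun D _ χ hD hq hp hA_ d l hd1 hl1 hdl => ?_⟩
  -- unpack the threshold
  have hDth : max ⌈Real.exp 3⌉₊ ⌈Real.exp (14 * |c'| * π)⌉₊ ≤ D := le_trans (le_max_left _ _) hD
  have hD' : max (max D₂₁ D₂₂) (max (max DE DLβ) ⌈Real.exp L₀⌉₊) ≤ D := le_trans (le_max_right _ _) hD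
  have hD₂₁ : D₂₁ ≤ D := le_trans (le_trans (le_max_left _ _) (le_max_left _ _)) hD'
  have hD₂₂ : D₂₂ ≤ D := le_trans (le_trans (le_max_right _ _) (le_max_left _ _)) hD'
  have hDE : DE ≤ D := le_trans (le_trans (le_trans (le_max_left _ _) (le_max_left _ _)) (le_max_right _ _)) hD'
  have hDLβ : DLβ ≤ D :=
    le_trans (le_trans (le_trans (le_max_right _ _) (le_max_left _ _)) (le_max_right _ _)) hD'
  have hDL₀ : ⌈Real.exp L₀⌉₊ ≤ D := le_trans (le_trans (le_max_right _ _) (le_max_right _ _)) hD'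
  obtain ⟨hL3, he⟩ := ResidueValues.thresholds c' hDth
  have hLL₀ : L₀ ≤ ell D := by
    have h : Real.exp L₀ ≤ D := le_trans (Nat.le_ceil _) (by exact_mod_cast hDL₀)
    exact (Real.le_log_iff_exp_le (lt_of_lt_of_le (Real.exp_pos _) h)).mpr h
  set L : ℝ := ell D with hLdef
  clear_value L
  have hL3' : 3 ≤ ell D := by rw [← hLdef]; exact hL3
  have he' : |c' * alpha D * ell D| ≤ 1 / 14 := by rw [← hLdef]; exact he
  have hL64 : 64 ≤ L := le_trans hL₀64 hLL₀
  have hLb : Lb ≤ L := le_trans hL₀b hLL₀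
  have hLg : Lg ≤ L := le_trans hL₀g hLL₀
  have hLκ₂ : max 4 ((41 / (8 * cbar / cL)) ^ 2) ≤ L := le_trans hL₀κ hLL₀
  have hL1700 : 1700 ≤ L := le_trans hL₀17 hLL₀
  have hLK1 : 16 * K₅ / cL + 1 ≤ L := le_trans hL₀K1 hLL₀
  have hLK2 : K₅ / rζ + 1 ≤ L := le_trans hL₀K2 hLL₀
  have hLK3 : K₅ + 1 ≤ L := le_trans hL₀K3 hLL₀
  have hL1 : 1 ≤ L := by linarith only [hL64]
  have hL0 : 0 < L := by linarith only [hL64]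
  -- the shifts and `P₄`
  obtain ⟨hb1l, hb1u, hb2l, hb2u, hb12, hb1', hb2', hβ1n, hα, hαeq⟩ := b_sizes c' hL3' he'
  rw [← hLdef] at hαeq
  obtain ⟨hP1, hP4le⟩ := P4_sizes hL3'
  rw [← hLdef] at hP4le
  have hb1 : 0 < b1 c' D := by linarith only [hb1l, hα]
  have hb2 : 0 < b2 c' D := by linarith only [hb2l, hα]
  have hb1π : π / L ^ 9 / 2 ≤ b1 c' D := by rw [← hαeq]; exact hb1l
  have hb2π : π / L ^ 9 ≤ b2 c' D := by rw [← hαeq]; exact hb2l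
  -- the character
  have hχ1 : χ ≠ 1 := by
    have hD1 : D ≠ 1 := by rintro rfl; rw [hLdef] at hL3; norm_num [ell] at hL3
    exact GammaFactor.ne_one_of_isPrimitive hp hD1
  have hd : d ≠ 0 := by omega
  -- the `ℳ₂` package
  have hM_diff : DifferentiableOn ℂ (calM2 c' χ d l) {s : ℂ | 9 / 10 < s.re} :=
    h21' D χ hD₂₁ hq hp d l hd1 hl1
  obtain ⟨W, hW⟩ : ∃ W : ℝ, W = ∏ q ∈ (d * l).primeFactors, (1 + c₂₂ / (q : ℝ) ^ (9 / 10 : ℝ)) :=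
    ⟨_, rfl⟩
  obtain ⟨KM, hKM⟩ : ∃ KM : ℝ, KM = C₂₂ * W := ⟨_, rfl⟩
  have hM_bd : ∀ w : ℂ, 9 / 10 < w.re → ‖calM2 c' χ d l w‖ ≤ KM := fun w hw => by
    rw [hKM, hW]; exact h22' D χ hD₂₂ hq hp d l hd1 hl1 w hw
  have hKM0 : 0 ≤ KM := le_trans (norm_nonneg _) (hM_bd 2 (by norm_num))
  -- the parameters `H`, `ℒ₁`, `η`, `B_ζ`, `M_inv`
  obtain ⟨H, hH⟩ : ∃ H : ℝ, H = L ^ 20 := ⟨_, rfl⟩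
  have hH2 : 2 ≤ H := by
    have : L ≤ L ^ 20 := le_self_pow₀ hL1 (by norm_num)
    rw [hH]; linarith only [this, hL64]
  have hH1 : 1 ≤ H := by linarith only [hH2]
  obtain ⟨ℒ₁, hℒ₁⟩ : ∃ ℒ₁ : ℝ, ℒ₁ = L + Real.log (H + 8) := ⟨_, rfl⟩
  have hlogH8 : 0 ≤ Real.log (H + 8) := Real.log_nonneg (by linarith only [hH1])
  have hℒ₁L : L ≤ ℒ₁ := by rw [hℒ₁]; linarith only [hlogH8]
  have hlogH8L : Real.log (H + 8) ≤ L := by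
    have h := log_pow_twenty_add_le (κ := 1) one_pos (L := L)
      (max_le (by linarith only [hL64]) (by norm_num; linarith only [hL1700]))
    rw [hH]; linarith only [h]
  have hℒ₁2L : ℒ₁ ≤ 2 * L := by rw [hℒ₁]; linarith only [hlogH8L]
  have hℒ₁0 : 0 < ℒ₁ := by linarith only [hℒ₁L, hL0]
  obtain ⟨η, hη⟩ : ∃ η : ℝ, η = cL / (4 * ℒ₁) := ⟨_, rfl⟩
  have hη0 : 0 < η := by rw [hη]; positivity
  have hηup : η ≤ cL / (4 * L) := by
    rw [hη]; exact div_le_div_of_nonneg_left hcL.le (by positivity) (by linarith only [hℒ₁L])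
  have hηlow : cL / (8 * L) ≤ η := by
    rw [hη]; exact div_le_div_of_nonneg_left hcL.le (by positivity) (by linarith only [hℒ₁2L])
  have hη20 : η ≤ 1 / 20 := by
    refine hηup.trans ?_
    rw [div_le_iff₀ (by positivity)]; linarith only [hcL4, hL64]
  have hη1 : η ≤ 1 := by linarith only [hη20]
  obtain ⟨Bζ, hBζ⟩ : ∃ Bζ : ℝ, Bζ = Cζ * Real.log (H + 5) := ⟨_, rfl⟩
  have hlogH5 : 0 ≤ Real.log (H + 5) := Real.log_nonneg (by linarith only [hH1])
  have hBζ0 : 0 ≤ Bζ := by rw [hBζ]; positivity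
  have hlogH5L : Real.log (H + 5) ≤ L := by
    have : Real.log (H + 5) ≤ Real.log (H + 8) :=
      Real.log_le_log (by linarith only [hH1]) (by linarith only [hH1])
    linarith only [this, hlogH8L]
  have hBζL : Bζ ≤ Cζ * L := by rw [hBζ]; exact mul_le_mul_of_nonneg_left hlogH5L hCζ.le
  obtain ⟨Minv, hMinv⟩ : ∃ Minv : ℝ, Minv = (CL + 1) * ℒ₁ := ⟨_, rfl⟩
  have hMinv0 : 0 < Minv := by rw [hMinv]; positivity
  have hMinvL : Minv ≤ 2 * (CL + 1) * L := by
    rw [hMinv]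
    have := mul_le_mul_of_nonneg_left hℒ₁2L (by positivity : (0 : ℝ) ≤ CL + 1)
    linarith only [this]
  -- the `ζ` package in the region `Re w ≥ 1 − 2η`, `|Im w| ≤ H + 2`
  have h2η : 2 * η ≤ 4 * cbar / Real.log (H + 5) := by
    have hlog8 : Real.log (L ^ 20 + 8) ≤ 8 * cbar / cL * L := log_pow_twenty_add_le hκ₂0 hLκ₂
    have hlog5 : Real.log (H + 5) ≤ 8 * cbar / cL * L := by
      have : Real.log (H + 5) ≤ Real.log (L ^ 20 + 8) :=
        Real.log_le_log (by linarith only [hH1]) (by rw [hH]; linarith only [hH1])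
      linarith only [this, hlog8]
    have hlog5pos : 0 < Real.log (H + 5) := Real.log_pos (by linarith only [hH1])
    calc 2 * η ≤ 2 * (cL / (4 * L)) := by linarith only [hηup]
      _ = 4 * cbar / (8 * cbar / cL * L) := by field_simp; ring
      _ ≤ 4 * cbar / Real.log (H + 5) :=
          div_le_div_of_nonneg_left (by positivity) hlog5pos hlog5
  have hζpk := zeta_package_of hcbar hCζ hζ hBζ h2η
  -- the exceptional zero and the `L` package
  have hA' : ‖χ.LFunction 1‖ < (Real.log D ^ 2022)⁻¹ := by rw [← one_div]; exact hA_
  obtain ⟨ρt, hρ1, hρK, hLρ, hL'ρ, hLreg⟩ := hE D χ hDE hχ1 hA'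
  have hLD : Real.log D = L := by rw [hLdef]; rfl
  have hρK' : 1 - ρt ≤ K₅ * (L ^ 2022)⁻¹ := by rw [← hLD]; exact hρK
  have hL2022 : L ≤ L ^ 2022 := le_self_pow₀ hL1 (by norm_num)
  have hKL : K₅ * (L ^ 2022)⁻¹ ≤ K₅ / L := by
    rw [div_eq_mul_inv]; exact mul_le_mul_of_nonneg_left (inv_anti₀ hL0 hL2022) hK₅.le
  have hKL1 : K₅ / L ≤ 1 := by rw [div_le_one hL0]; linarith only [hLK3]
  have hρ0 : 0 ≤ ρt := by linarith only [hρK', hKL, hKL1]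
  have hρη : 1 - η / 2 ≤ ρt := by
    have h1 : K₅ * (L ^ 2022)⁻¹ ≤ cL / (16 * L) := by
      have hL2021 : 16 * K₅ / cL ≤ L ^ 2021 := by
        have : L ≤ L ^ 2021 := le_self_pow₀ hL1 (by norm_num)
        linarith only [this, hLK1]
      rw [div_le_iff₀ hcL] at hL2021
      have hpow : L ^ 2022 = L * L ^ 2021 := by ring
      rw [← div_eq_mul_inv, div_le_div_iff₀ (by positivity) (by positivity), hpow]
      have h16 : K₅ * (16 * L) = (16 * K₅) * L := by ring
      have hcc : cL * (L * L ^ 2021) = (L ^ 2021 * cL) * L := by ring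
      rw [h16, hcc]
      exact mul_le_mul_of_nonneg_right hL2021 hL0.le
    have h2 : cL / (16 * L) ≤ η / 2 := by
      have : cL / (16 * L) = cL / (8 * L) / 2 := by ring
      rw [this]; linarith only [hηlow]
    linarith only [hρK', h1, h2]
  have hLpk := L_package_of hcL hCL hLreg hLD hL0 hH1 hℒ₁ hη hMinv
  -- `ζ` next to `1` at `ρ̃`
  have hζρ : ‖((ρt : ℂ) - 1) * riemannZeta ρt - 1‖ ≤ 1 / 2 := by
    have hρne : (ρt : ℂ) ≠ 1 := by
      intro h
      have := congrArg Complex.re h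
      simp only [Complex.ofReal_re, Complex.one_re] at this
      linarith only [this, hρ1]
    have hdist : ‖(ρt : ℂ) - 1‖ < rζ := by
      rw [← Complex.ofReal_one, ← Complex.ofReal_sub, Complex.norm_real, Real.norm_eq_abs,
        abs_of_nonpos (by linarith only [hρ1])]
      have hLr : K₅ / rζ < L := by linarith only [hLK2]
      rw [div_lt_iff₀ hrζ] at hLr
      have : K₅ / L < rζ := by rw [div_lt_iff₀ hL0]; linarith only [hLr]
      linarith only [this, hρK', hKL]
    exact (hζ1 (ρt : ℂ) hρne hdist).2.2
  -- `L(1 − βⱼ, χ) ≠ 0`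
  have hLβ' := hLβ D χ hDLβ hq hp hA_
  have hL1ne : χ.LFunction (1 - beta1 c' D) ≠ 0 :=
    (hLβ' (beta1 c' D) (ResidueValues.norm_beta_ge c' hL3' he').1
      ((ResidueValues.norm_beta1_le c' hL3' he').trans (by linarith only [hα]))).1
  have hL2ne : χ.LFunction (1 - beta2 c' D) ≠ 0 :=
    (hLβ' (beta2 c' D) (ResidueValues.norm_beta_ge c' hL3' he').2.1
      (ResidueValues.norm_beta2_le c' hL3' he')).1
  -- `d ≤ P`, `d^{1−ρ̃} ≤ e`, `(d/P₄)^η ≤ e^{−18η𝓛^{1.1}}`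
  have hdreal : (d : ℝ) ≤ ((d * l : ℕ) : ℝ) := by
    have : d ≤ d * l := Nat.le_mul_of_pos_right d (by omega)
    exact_mod_cast this
  have hdP : (d : ℝ) ≤ Real.exp (L ^ 9) := by
    have h1 := Typed.Section16ALeaves.suppBound_le_bigP (D := D) (by rw [← hLdef]; linarith only [hL64])
    have h2 : bigP D = Real.exp (L ^ 9) := by rw [bigP, hLdef]
    linarith only [hdreal, hdl, h1, h2.le]
  have hd1r : (1 : ℝ) ≤ d := by exact_mod_cast hd1
  have hE5 : (d : ℝ) ^ (1 - ρt) ≤ Real.exp 1 := by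
    rw [Real.rpow_def_of_pos (by positivity)]
    refine Real.exp_le_exp.mpr ?_
    have hlogd : Real.log d ≤ L ^ 9 := by
      have h := Real.log_le_log (by positivity) hdP
      rwa [Real.log_exp] at h
    have hlogd0 : 0 ≤ Real.log d := Real.log_nonneg hd1r
    have h9 : K₅ * (L ^ 2022)⁻¹ * L ^ 9 ≤ 1 := by
      have hL2013 : K₅ ≤ L ^ 2013 := by
        have : L ≤ L ^ 2013 := le_self_pow₀ hL1 (by norm_num)
        linarith only [this, hLK3]
      have hpow : L ^ 2022 = L ^ 2013 * L ^ 9 := by ring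
      rw [hpow, mul_inv, mul_assoc, inv_mul_cancel_right₀ (pow_ne_zero 9 hL0.ne')]
      rw [← div_eq_mul_inv, div_le_one (by positivity)]
      exact hL2013
    calc Real.log d * (1 - ρt) ≤ L ^ 9 * (K₅ * (L ^ 2022)⁻¹) :=
          mul_le_mul hlogd hρK' (by linarith only [hρ1]) (by positivity)
      _ ≤ 1 := by linarith only [h9]
  have hdPη : ((d : ℝ) / P4 D) ^ η ≤ Real.exp (-(6 * η * L ^ (1.1 : ℝ))) := by
    have h := div_P4_rpow_le_supp (D := D) (by rw [← hLdef]; linarith only [hL64]) hdreal hdl hη0.le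
    rwa [← hLdef] at h
  -- the decay exponent `X = (3c/4)L^{1/10}`: `6ηL^{1.1} ≥ 6(c/(8L))·L·L^{1/10} = X`
  have hdX : ((d : ℝ) / P4 D) ^ η ≤ Real.exp (-(3 * cL / 4 * L ^ (1 / 10 : ℝ))) := by
    refine hdPη.trans (Real.exp_le_exp.mpr ?_)
    have h11 : L ^ (1.1 : ℝ) = L * L ^ (1 / 10 : ℝ) := by
      rw [show (1.1 : ℝ) = 1 + 1 / 10 by norm_num, Real.rpow_add hL0, Real.rpow_one]
    rw [h11, neg_le_neg_iff]
    have hpow0 : 0 ≤ L ^ (1 / 10 : ℝ) := Real.rpow_nonneg hL0.le _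
    have h1 : cL / (8 * L) * (L * L ^ (1 / 10 : ℝ)) ≤ η * (L * L ^ (1 / 10 : ℝ)) :=
      mul_le_mul_of_nonneg_right hηlow (by positivity)
    have h2 : cL / (8 * L) * (L * L ^ (1 / 10 : ℝ)) = cL / 8 * L ^ (1 / 10 : ℝ) := by
      field_simp
    calc 3 * cL / 4 * L ^ (1 / 10 : ℝ) = 6 * (cL / 8 * L ^ (1 / 10 : ℝ)) := by ring
      _ ≤ 6 * (η * (L * L ^ (1 / 10 : ℝ))) := by rw [← h2]; linarith
      _ = 6 * η * (L * L ^ (1 / 10 : ℝ)) := by ring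
  -- the Gaussian budget and the stretched exponential
  have hg0 : 0 ≤ GaussWeight.gauss (4 * L ^ 30)⁻¹ (H - |b2 c' D|) := (GaussWeight.gauss_pos _ _).le
  have hgb : L ^ 2600 * Real.exp (2 * L ^ 9 + 2) * GaussWeight.gauss (4 * L ^ 30)⁻¹ (H - |b2 c' D|) ≤
      1 := by
    have hgle : GaussWeight.gauss (4 * L ^ 30)⁻¹ (H - |b2 c' D|) ≤
        Real.exp (-(L ^ 20 - 1) ^ 2 / (4 * L ^ 30)) := by
      rw [GaussWeight.gauss, abs_of_pos hb2]
      refine Real.exp_le_exp.mpr ?_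
      have h20 : 1 ≤ L ^ 20 := one_le_pow₀ hL1
      have h1 : (L ^ 20 - 1) ^ 2 ≤ (H - b2 c' D) ^ 2 := by
        rw [hH]
        exact pow_le_pow_left₀ (by linarith only [h20]) (by linarith only [hb2']) 2
      rw [neg_div, neg_mul, neg_le_neg_iff, div_eq_inv_mul]
      exact mul_le_mul_of_nonneg_left h1 (by positivity)
    have hb := hbudget L hLb
    have hL2600 : L ^ (2600 : ℝ) = L ^ 2600 := by norm_cast
    rw [hL2600] at hb
    exact le_trans (mul_le_mul_of_nonneg_left hgle (by positivity)) hb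
  have hG' : L ^ (2020 : ℝ) ≤ Real.exp (3 * cL / 4 * L ^ (1 / 10 : ℝ)) := hG L hLg
  -- the local theorem and the numerics
  have hell1 : 1 ≤ ell D := by rw [← hLdef]; exact hL1
  have hloc := integral_u023_sub_residues_le_local c' χ d l hχ1 hd (E := Real.exp 1) hη0 hη20 hH2
    hell1 hP1 hb1 hb1' hb2 hb2' hb12 hβ1n hM_diff hKM0 hM_bd hBζ0 hζpk hMinv0 hρ0 hρ1 hρη hLρ hL'ρ
    hLpk hζρ hL1ne hL2ne hE5
  rw [← hLdef] at hloc
  refine hloc.trans ?_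
  have hWrw : C₂₂ * (48 / π +
      1 / (2 * π) * ((8 / cL + Cζ) * Cζ * (2 * (CL + 1)) * (1 + 16 / cL) * (24 / cL) * 4) +
      36 * (1 + Cζ) * Cζ * (CL + 1) / π + 2 * (CL + 1) * (2 / π + Cζ) * (2 * K₅) * 3 * (3 / π)) *
      (∏ q ∈ (d * l).primeFactors, (1 + c₂₂ / (q : ℝ) ^ (9 / 10 : ℝ))) * (L ^ 2000)⁻¹ =
      KM * (48 / π +
      1 / (2 * π) * ((8 / cL + Cζ) * Cζ * (2 * (CL + 1)) * (1 + 16 / cL) * (24 / cL) * 4) +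
      36 * (1 + Cζ) * Cζ * (CL + 1) / π + 2 * (CL + 1) * (2 / π + Cζ) * (2 * K₅) * 3 * (3 / π)) *
      (L ^ 2000)⁻¹ := by rw [hKM, hW]; ring
  rw [hWrw]
  exact numeric_bound_X hL64 hη0 hη1 hηlow hcL hH hBζ0 hBζL hCζ hMinv0 hMinvL hCL hKM0 hρ1 hρK' hK₅
    hb1π hb2π hb2' hP1 hP4le hd1r hdP hdX hg0 hgb hG'

end Main

end Literature.NumberTheory.LFunctions.Zhang2022.Eq1610

namespace Literature.NumberTheory.LFunctions.Zhang2022.Typed.Section16A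

/-- **(16.10) HOLDS in the reading of record** (weighted polynomial rate, on the support of `b₁`,
coprimality of `l` only — the hypothesis `h10` of `eq16_12_of_eq16_5P_of_eq16_10_weighted`, RT16-int-2
amended 2026-08-27), every `c′`: u023 (`step16_u023_holds`) + the contour estimate on the support
(`Eq1610.integral_u023_sub_residues_le_supp` from `step16_u021an_holds`, `step16_u022_holds`) through
`eq16_10W_of_integral_bound_pow`. CONDITIONAL on (A) inside `ForAllLarge`, as the manuscript.
[cite: Zhang2022LandauSiegel, §16 (16.10) p.92] -/
theorem eq16_10W_holds (c' : ℝ) : ∃ c₀ C : ℝ, ForAllLarge fun D _ χ => AssumptionA D χ →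
      ∀ d l : ℕ, 1 ≤ d → 1 ≤ l →
        ((d * l : ℕ) : ℝ) < 2 * bigT D ^ 2 * (bigP D ^ (1 / 2 : ℝ) * max (Skeleton.P2 D) (P3 D)) →
        Nat.Coprime l D →
        ‖calD2 c' χ d l - lam2 c' χ d 1 * ∑ j ∈ ({1, 2} : Finset ℕ),
            calR2 c' χ j * (d : ℂ) ^ betaJ c' D j * calM2 c' χ d l (1 - betaJ c' D j)‖ ≤
          C * (∏ q ∈ (d * l).primeFactors, (1 + c₀ / (q : ℝ) ^ (9 / 10 : ℝ))) * (ell D ^ 120)⁻¹ :=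
  eq16_10W_of_integral_bound_pow c' 2000 (by norm_num)
    (Eq1610.integral_u023_sub_residues_le_supp c' (step16_u021an_holds c') (step16_u022_holds c'))

/-- **THE LEAF `h16_12`: (16.12) HOLDS for every `c′`** — `Φ₂(p) = (ℛ₂*Dp/φ(D))Σ_{j=1,2} ℛ₂ⱼ𝒮₂ⱼ + o(p)`
for all large `D`, every real primitive `χ (mod D)` satisfying (A), and every `p ∼ P` [Z22 (16.12) p. 92]:
`eq16_12_of_eq16_10W` (i.e. (16.5)ᴾ `eq16_5P_holds` + the insertion `eq16_12_of_eq16_5P_of_eq16_10_weighted`)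
fed with `eq16_10W_holds`. CONDITIONAL on (A) inside `ForAllLarge`, exactly as the manuscript; this is a
typed step of the source, not a statement about Landau–Siegel zeros.
[cite: Zhang2022LandauSiegel, §16 (16.12) p.92] -/
theorem eq16_12_holds (c' : ℝ) : Eq16_12 c' := eq16_12_of_eq16_10W c' (eq16_10W_holds c')

variable (c' : ℝ) in
/-- `Eq16_12` — `_holds` alias of `eq16_12_holds` above under the fact's exact name, stated under the
prover's own binders as section variables (appended 2026-08-28, D-0026 bookkeeping: the proof term is the
existing theorem of this file; no statement, definition or attribute is edited; no new named fact; the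
ledger's debt table listed the fact unproved). [cite: Zhang2022LandauSiegel, §16 (16.12) p.92] -/
theorem _root_.Literature.NumberTheory.LFunctions.Zhang2022.Typed.Section16A.Eq16_12_holds :
    _root_.Literature.NumberTheory.LFunctions.Zhang2022.Typed.Section16A.Eq16_12 c' :=
  _root_.Literature.NumberTheory.LFunctions.Zhang2022.Typed.Section16A.eq16_12_holds (c' := c')

/-- The skeleton binder shape `∀ c′, Eq16_12 c′`. [cite: Zhang2022LandauSiegel, §16 (16.12) p.92] -/
theorem eq16_12_holds_all : ∀ c' : ℝ, Eq16_12 c' := eq16_12_holds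

end Literature.NumberTheory.LFunctions.Zhang2022.Typed.Section16A
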